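import Summits.KontsevichZagierPeriods.KontsevichZagierPeriods.Theorems.RootDecompWalshStrataConicConst

/-!
# Root decomposition & Walsh strata — the conic-wall terminal, part 5a: the symmetric scaled class (gen 8, §36.9)

Route `RootDecompWalshStrata`, leaf `QuadricBakerDescent` (stmt-27597), residual R-E2 (NODE.md, decomp-kz-lens-4).
A small extension of the landed scaled class `InBaker.sqrt_const_div_W` (`N(t)/(κ₀ + κ₁t²)·√m` on
`0 ≤ t ≤ 1`) to `|t| ≤ 1`: split at `t = 0` and reflect the negative half (`N ↦ N ∘ (−X)`; the
denominator is even).  Used by the double-root stratum of the conic-wall terminal (part 5b).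
[KontsevichZagier2001 §1.2; this node]
-/

noncomputable section

open Set MeasureTheory Literature.NumberTheory.Transcendental
open Literature.ModelTheory.ExponentialFields (IsSemialgebraic isSemialgebraic_univ
  isSemialgebraic_setOf_eval_pos)

namespace Summit.KontsevichZagierPeriods.RootDecompWalshStrata.ConicDescent

/-! #### 36.9 The double-root radicand stratum -/

/-- `posHalfLine` is `ℚ`-semialgebraic. [BCR1998 §2.2] -/
private theorem isSemialgebraic_posHalfLine'' : IsSemialgebraic ℚ {v : Fin 1 → ℝ | 0 < v 0} := by
  simpa using isSemialgebraic_setOf_eval_pos (k := ℚ) (R := ℝ)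
    (MvPolynomial.X 0 : MvPolynomial (Fin 1) ℚ)

/-- The scaled class `N(t)/(κ₀ + κ₁t²)·√m` on `|t| ≤ 1`: split at `t = 0` and reflect the negative
half (`N ↦ N ∘ (−X)`; the denominator is even). [this node] -/
theorem InBaker.sqrt_const_div_W_sym (m : ℚ) (hm : 0 < m) (κ₀ κ₁ : ℚ) (hκ₀ : 0 < κ₀)
    (hκ₁ : 0 ≤ κ₁) (N : Polynomial ℚ) (r : KZ.IntegralRep 1) (hI : ∀ v ∈ r.domain, |v 0| ≤ 1)
    (hr : EqOn r.integrand (fun v => Polynomial.aeval (v 0) N /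
      Polynomial.aeval (v 0) (Polynomial.C κ₀ + Polynomial.C κ₁ * Polynomial.X ^ 2) *
        √(qD 0 0 m (v 0))) r.domain) :
    InBaker (KZ.of r) := by
  have hDx : ∀ x : ℝ, Polynomial.aeval x (Polynomial.C κ₀ + Polynomial.C κ₁ * Polynomial.X ^ 2) =
      (κ₀ : ℝ) + κ₁ * x ^ 2 := fun x => by
    simp only [map_add, map_mul, map_pow, Polynomial.aeval_C, Polynomial.aeval_X, eq_ratCast]
  have hκ₀' : (0 : ℝ) < κ₀ := by exact_mod_cast hκ₀
  have hκ₁' : (0 : ℝ) ≤ κ₁ := by exact_mod_cast hκ₁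
  have hDpos : ∀ x : ℝ, (0 : ℝ) < κ₀ + κ₁ * x ^ 2 := fun x =>
    add_pos_of_pos_of_nonneg hκ₀' (mul_nonneg hκ₁' (sq_nonneg _))
  have hqD : ∀ x : ℝ, qD 0 0 m x = m := fun x => by simp [qD]
  refine InBaker.of_split_at 0 r (fun r₁ hd₁ hi₁ => ?_) fun r₁ hd₁ hi₁ => ?_
  · refine InBaker.sqrt_const_div_W m hm κ₀ κ₁ hκ₀ hκ₁ N r₁ (fun v hv => ?_) fun v hv => ?_
    · rw [hd₁] at hv
      have h2 : (0 : ℝ) < v 0 := by simpa using hv.2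
      exact ⟨h2.le, (abs_le.1 (hI v hv.1)).2⟩
    · rw [hi₁]
      rw [hd₁] at hv
      exact hr hv.1
  · have hT₀ := isSemialgebraic_posHalfLine''
    refine InBaker.of_reflect' 0 r₁ hT₀ (fun x hx => ?_)
      (fun v => Polynomial.aeval (v 0) (N.comp (-Polynomial.X)) /
        Polynomial.aeval (v 0) (Polynomial.C κ₀ + Polynomial.C κ₁ * Polynomial.X ^ 2) *
          √(qD 0 0 m (v 0))) ?_ (fun v _ hvd => ?_) fun r₂ hd₂ hi₂ => ?_
    · rw [hd₁] at hx
      have h2 : x 0 < 0 := by simpa using hx.2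
      show (0 : ℝ) < ((0 : ℚ) : ℝ) - x 0
      push_cast
      linarith
    · exact ((((IsRatOn.polyAeval (N.comp (-Polynomial.X)) IsRatOn.coord).div
        (IsRatOn.polyAeval _ IsRatOn.coord) fun v _ => by
          rw [hDx]; exact (hDpos (v 0)).ne').isSemialgebraicFunOn hT₀).mul_holds
        (IsSemialgebraicFunOn.sqrt_holds (isSemialgebraicFunOn_qD 0 0 m hT₀))).congr fun v _ => by
        simp only [Pi.mul_apply]
    · have hp : (fun _ : Fin 1 => ((0 : ℚ) : ℝ) - v 0) ∈ r.domain := by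
        rw [hd₁] at hvd; exact hvd.1
      rw [hi₁, hr hp]
      simp only [Rat.cast_zero, zero_sub, Polynomial.aeval_comp, map_neg, Polynomial.aeval_X, hDx,
        hqD, neg_sq]
    · refine InBaker.sqrt_const_div_W m hm κ₀ κ₁ hκ₀ hκ₁ (N.comp (-Polynomial.X)) r₂
        (fun v hv => ?_) fun v _ => by rw [hi₂]
      rw [hd₂] at hv
      have h1 : (0 : ℝ) < v 0 := hv.1
      have h3 : (fun _ : Fin 1 => ((0 : ℚ) : ℝ) - v 0) ∈ r.domain := by
        have h := hv.2
        rw [hd₁] at h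
        exact h.1
      have h4 := hI _ h3
      simp only [Rat.cast_zero, zero_sub, abs_neg] at h4
      exact ⟨h1.le, (abs_le.1 h4).2⟩

end Summit.KontsevichZagierPeriods.RootDecompWalshStrata.ConicDescent

end
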